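import Literature.MathematicalPhysics.QuantumLattice.HubbardTTPrimeTorusFreeEnergyConcavity
import Literature.MathematicalPhysics.QuantumLattice.HubbardGrandCanonicalDensity
import Literature.MathematicalPhysics.QuantumLattice.HubbardTTPrimeScaleHomogeneity
import HarnessLib

/-!
# The thermal density of the grand-canonical `t–t'` Hubbard torus is continuous and increasing in the
# chemical potential: the `T > 0` chemical-potential cell of a filling box (finite volume, every `L`)

Family `hubbard` (topic `MathematicalPhysics/QuantumLattice`; companion of
`HubbardTTPrimeTorusFreeEnergyConcavity` (joint concavity of the finite-volume grand-canonical free energy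
of the `t–t'` torus in `(t, t', U, μ)`; the `T > 0` Griffiths bracket on the particle number
`re_gibbsState_totalNumber_mem_Icc_freeEnergy_slopes`), of `HubbardGrandCanonicalDensity` (the `T = 0`
tracial ground-state density: `gcNumber_mono`, a-priori bounds) and of
`HubbardFillingBoxChemicalPotentialCell` (the `T = 0` thermodynamic-limit `μ`-cell of a filling box,
`chemPot_mem_cell_of_mem_Icc`, `exists_chemPot_mem_cell_isMinOn_of_mem_Icc`)). Written for the FILLING leg of
the material-oracle interface BOX → WORD at positive temperature (Hubbard programme, stages S1/S2 (iii)): a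
downfolded material arrives with a filling interval `n ∈ [n₁, n₂]`, a grand-canonical thermal certificate
is solved at chemical potentials `μ`; the two meet through the thermal equation of state
`N_β(μ) = Re ⟨N⟩_{β, H_L(t,t',U) − μN}` of the FINITE torus `(ℤ/Lℤ)²`, for which we prove, at every
`β > 0` and every `L`:

* §1 `re_gibbsState_totalNumber_mono_chemPot` — `μ ≤ μ' ⇒ N_β(μ) ≤ N_β(μ')` (the two Peierls–Bogoliubov /
  Griffiths brackets at `μ` and `μ'` share the secant of the concave free energy);
  `hasDerivAt_re_gibbsState_totalNumber_chemPot`, `continuous_re_gibbsState_totalNumber_chemPot` —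
  differentiability (susceptibility formula, `β × Duhamel variance`) and continuity in `μ`;
  `re_gibbsState_totalNumber_mem_Icc` — `0 ≤ N_β(μ) ≤ 2L²`.
* §2 THE THERMAL `μ`-CELL OF A FILLING BOX: `exists_chemPot_mem_Icc_re_gibbsState_totalNumber_eq` — every
  value between `N_β(μ_lo)` and `N_β(μ_hi)` is attained on `[μ_lo, μ_hi]` (intermediate value theorem);
  `exists_chemPot_mem_Icc_thermalDensity_eq_of_rows` — two certified rows `N_β(μ_lo) ≤ n₁L²`,
  `n₂L² ≤ N_β(μ_hi)` put, for EVERY filling `n ∈ [n₁, n₂]`, a chemical potential `μ ∈ [μ_lo, μ_hi]` with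
  thermal density exactly `n` — a grand-canonical `μ`-scan over `[μ_lo, μ_hi]` COVERS the filling box (the
  `T > 0`, finite-volume twin of `exists_chemPot_mem_cell_isMinOn_of_mem_Icc`); conversely
  `re_gibbsState_totalNumber_mem_Icc_of_mem_Icc_chemPot` / `…_of_rows` / `…_of_mem_uIcc` — on a `μ`-cell the
  thermal density is LOCALISED between the endpoint densities (resp. their certified bounds).
* §3 `gibbsState_totalNumber_hubbardTorusTT'_grandCanonical_eq_unit` — dimensionless form: the thermal particle number of
  `H_L(t,t',U) − μN` at `β` is that of `H_L(1,t'/t,U/t) − (μ/t)N` at `βt` (`t > 0`), so the `μ`-cell of a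
  physical box reads in `μ/t` against `k_BT/t` (`HubbardTTPrimeScaleHomogeneity` §4 with zero field).

HONEST SCOPE: finite volume, every `L`; exact monotonicity/continuity and their interval consequences only —
no thermodynamic limit of the equation of state, no bound on `∂N/∂μ` (that is Kubo–Kishi's
`hubbardTorus_halfFilled_compressibility_le` at half filling), no certificate, no number. Everything is
PROVED; no definition, no named fact.

## References

* D. Ruelle, *Statistical Mechanics: Rigorous Results* (1969), §3.4.5–3.4.6 (the grand-canonical ensemble;
  density increasing in the chemical potential; equivalence of ensembles). [cite: Ruelle1969, §3.4]
* E. H. Lieb, Commun. Math. Phys. 31 (1973) 327, §V (5.2)–(5.4) (`λ⟨A⟩ ≥ f(λ) − f(0)`, the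
  Peierls–Bogoliubov bracket). [cite: Lieb1973, §V (5.2)–(5.4)]
* O. Bratteli, D. W. Robinson, *Operator Algebras and Quantum Statistical Mechanics 2* (1997), §5.4.1
  (linear response = Duhamel two-point function). [cite: BratteliRobinsonII1997, §5.4.1]

## Mathlib / tree search

REUSED: `re_gibbsState_totalNumber_mem_Icc_freeEnergy_slopes`, `isHermitian_hubbardTorusTT'_sub_mu`
(`HubbardTTPrimeTorusFreeEnergyConcavity`); `hasDerivAt_re_gibbsState_source`
(`ApproximatingHamiltonianProofs`); `gibbsState_nonneg_of_posSemidef`, `gibbsState_one`, `partitionFn_re_pos`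
(`FinDimSpectrum`, `ApproximatingHamiltonianProofs`); `posSemidef_totalNumber`, `posSemidef_two_mul_card_sub_totalNumber`
(`HubbardGrandCanonicalDensity`); `gibbsState_hubbardTorusTT'_grandCanonical_eq_unit`
(`HubbardTTPrimeScaleHomogeneity`); Mathlib `intermediate_value_Icc`.
`lean search 'gibbsState.*totalNumber'`: no monotonicity-in-`μ` statement at `T > 0` in the tree (the `T = 0`
one is `gcNumber_mono`).
-/

noncomputable section

namespace Literature.MathematicalPhysics.QuantumLattice

open Matrix Finset HubbardWave0
open scoped Matrix.Norms.L2Operator ComplexOrder BigOperators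

/-! ### §1 Monotonicity, differentiability, continuity and a priori bounds in `μ` -/

section Monotone

variable (L : ℕ)

/-- **The thermal density of the grand-canonical `t–t'` torus increases with the chemical potential**:
for `β > 0` and `μ ≤ μ'`, `Re⟨N⟩_{β, H_L(t,s,U) − μN} ≤ Re⟨N⟩_{β, H_L(t,s,U) − μ'N}` (the Peierls–Bogoliubov
brackets at `μ` and at `μ'` share the secant slope of the concave free energy on `[μ, μ']`).
[cite: Ruelle1969, §3.4] [cite: Lieb1973, §V (5.2)–(5.4)] -/
theorem re_gibbsState_totalNumber_mono_chemPot {β : ℝ} (hβ : 0 < β) (t s U : ℝ) {μ μ' : ℝ} (h : μ ≤ μ') :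
    (gibbsState β (hubbardTorusTT' L t s U - (μ : ℂ) • totalNumber) totalNumber).re ≤
      (gibbsState β (hubbardTorusTT' L t s U - (μ' : ℂ) • totalNumber) totalNumber).re := by
  rcases eq_or_lt_of_le h with heq | hlt
  · rw [heq]
  · have hh : 0 < μ' - μ := sub_pos.mpr hlt
    have h1 := (re_gibbsState_totalNumber_mem_Icc_freeEnergy_slopes L hβ t s U μ hh).2
    have h2 := (re_gibbsState_totalNumber_mem_Icc_freeEnergy_slopes L hβ t s U μ' hh).1
    rw [show μ + (μ' - μ) = μ' by ring] at h1
    rw [show μ' - (μ' - μ) = μ by ring] at h2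
    exact h1.trans h2

/-- **Susceptibility formula**: `μ ↦ Re⟨N⟩_{β, H_L(t,s,U) − μN}` is differentiable, with derivative
`β·((N,N)_Duh − ⟨N⟩²)` at `μ` (`β` times the Duhamel variance of `N`). [cite: BratteliRobinsonII1997, §5.4.1] -/
theorem hasDerivAt_re_gibbsState_totalNumber_chemPot {β : ℝ} (hβ : 0 < β) (t s U μ : ℝ) :
    HasDerivAt (fun m : ℝ => (gibbsState β (hubbardTorusTT' L t s U - (m : ℂ) • totalNumber) totalNumber).re)
      (β * ((duhamel β (hubbardTorusTT' L t s U - (μ : ℂ) • totalNumber) totalNumber totalNumber).re -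
        (gibbsState β (hubbardTorusTT' L t s U - (μ : ℂ) • totalNumber) totalNumber).re ^ 2)) μ := by
  haveI : Nonempty (Finset (Orb (FermionTorus 2 L))) := ⟨∅⟩
  exact hasDerivAt_re_gibbsState_source (hubbardTorusTT'_isHermitian L t s U) totalNumber_isHermitian hβ μ

/-- The thermal density is continuous in the chemical potential. [cite: BratteliRobinsonII1997, §5.4.1] -/
theorem continuous_re_gibbsState_totalNumber_chemPot {β : ℝ} (hβ : 0 < β) (t s U : ℝ) :
    Continuous (fun m : ℝ =>
      (gibbsState β (hubbardTorusTT' L t s U - (m : ℂ) • totalNumber) totalNumber).re) :=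
  continuous_iff_continuousAt.mpr fun μ =>
    (hasDerivAt_re_gibbsState_totalNumber_chemPot L hβ t s U μ).continuousAt

/-- **A priori bounds**: `0 ≤ Re⟨N⟩_{β, H_L(t,s,U) − μN} ≤ 2L²` (`0 ≤ N ≤ 2|Λ|` as operators, positivity of
the Gibbs state). [cite: Ruelle1969, §3.4] -/
theorem re_gibbsState_totalNumber_mem_Icc (β t s U μ : ℝ) :
    (gibbsState β (hubbardTorusTT' L t s U - (μ : ℂ) • totalNumber) totalNumber).re ∈
      Set.Icc (0 : ℝ) (2 * (L : ℝ) ^ 2) := by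
  haveI : Nonempty (Finset (Orb (FermionTorus 2 L))) := ⟨∅⟩
  have hH := isHermitian_hubbardTorusTT'_sub_mu L t s U μ
  have hZ : partitionFn β (hubbardTorusTT' L t s U - (μ : ℂ) • totalNumber) ≠ 0 := by
    rw [partitionFn_eq_re hH β, Ne, Complex.ofReal_eq_zero]
    exact (partitionFn_re_pos hH β).ne'
  constructor
  · have h := gibbsState_nonneg_of_posSemidef β hH (posSemidef_totalNumber (Λ := FermionTorus 2 L))
    exact (Complex.nonneg_iff.mp h).1
  · -- `N ≤ 2|Λ|` as operators, restated with the ambient decidability instances (subsingletons)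
    have hps : ((((2 * Fintype.card (FermionTorus 2 L) : ℕ) : ℂ) •
        (1 : Matrix (Finset (Orb (FermionTorus 2 L))) (Finset (Orb (FermionTorus 2 L))) ℂ)) -
        totalNumber).PosSemidef := by
      convert posSemidef_two_mul_card_sub_totalNumber (Λ := FermionTorus 2 L)
    have h := gibbsState_nonneg_of_posSemidef β hH hps
    rw [map_sub, map_smul, gibbsState_one β _ hZ] at h
    obtain ⟨hre, -⟩ := Complex.nonneg_iff.mp h
    simp only [Complex.sub_re, smul_eq_mul, mul_one, Complex.natCast_re] at hre
    have hcard : ((2 * Fintype.card (FermionTorus 2 L) : ℕ) : ℝ) = 2 * (L : ℝ) ^ 2 := by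
      simp [FermionTorus, sq]
    linarith

end Monotone

/-! ### §2 The thermal `μ`-cell of a filling box (finite volume, every `L`) -/

section Cell

variable (L : ℕ)

/-- **Intermediate values**: for `β > 0`, `μ_lo ≤ μ_hi` and every `ν` with
`Re⟨N⟩_{β,μ_lo} ≤ ν ≤ Re⟨N⟩_{β,μ_hi}` there is `μ ∈ [μ_lo, μ_hi]` with `Re⟨N⟩_{β,μ} = ν` (continuity).
[cite: Ruelle1969, §3.4] -/
theorem exists_chemPot_mem_Icc_re_gibbsState_totalNumber_eq {β : ℝ} (hβ : 0 < β) (t s U : ℝ)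
    {μlo μhi : ℝ} (hle : μlo ≤ μhi) {ν : ℝ}
    (h1 : (gibbsState β (hubbardTorusTT' L t s U - (μlo : ℂ) • totalNumber) totalNumber).re ≤ ν)
    (h2 : ν ≤ (gibbsState β (hubbardTorusTT' L t s U - (μhi : ℂ) • totalNumber) totalNumber).re) :
    ∃ μ ∈ Set.Icc μlo μhi,
      (gibbsState β (hubbardTorusTT' L t s U - (μ : ℂ) • totalNumber) totalNumber).re = ν := by
  have hcont := (continuous_re_gibbsState_totalNumber_chemPot L hβ t s U).continuousOn (s := Set.Icc μlo μhi)
  exact intermediate_value_Icc hle hcont ⟨h1, h2⟩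

/-- **A grand-canonical `μ`-scan COVERS a filling box** (`T > 0`, finite volume): two certified rows
`Re⟨N⟩_{β,μ_lo} ≤ n₁·L²` and `n₂·L² ≤ Re⟨N⟩_{β,μ_hi}` (`μ_lo ≤ μ_hi`) give, for EVERY filling `n ∈ [n₁, n₂]`,
a chemical potential `μ ∈ [μ_lo, μ_hi]` whose thermal density is exactly `n`: `Re⟨N⟩_{β,μ} = n·L²`. The
`T > 0` twin of `exists_chemPot_mem_cell_isMinOn_of_mem_Icc`. [cite: Ruelle1969, §3.4] -/
theorem exists_chemPot_mem_Icc_thermalDensity_eq_of_rows {β : ℝ} (hβ : 0 < β) (t s U : ℝ)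
    {μlo μhi : ℝ} (hle : μlo ≤ μhi) {n₁ n₂ : ℝ}
    (hlo : (gibbsState β (hubbardTorusTT' L t s U - (μlo : ℂ) • totalNumber) totalNumber).re ≤
      n₁ * (L : ℝ) ^ 2)
    (hhi : n₂ * (L : ℝ) ^ 2 ≤
      (gibbsState β (hubbardTorusTT' L t s U - (μhi : ℂ) • totalNumber) totalNumber).re)
    {n : ℝ} (hn : n ∈ Set.Icc n₁ n₂) :
    ∃ μ ∈ Set.Icc μlo μhi,
      (gibbsState β (hubbardTorusTT' L t s U - (μ : ℂ) • totalNumber) totalNumber).re = n * (L : ℝ) ^ 2 := by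
  have hL2 : (0 : ℝ) ≤ (L : ℝ) ^ 2 := sq_nonneg _
  exact exists_chemPot_mem_Icc_re_gibbsState_totalNumber_eq L hβ t s U hle
    (hlo.trans (mul_le_mul_of_nonneg_right hn.1 hL2)) ((mul_le_mul_of_nonneg_right hn.2 hL2).trans hhi)

/-- **On a `μ`-cell the thermal density is localised between the endpoint densities**: for
`μ ∈ [μ_lo, μ_hi]`, `Re⟨N⟩_{β,μ_lo} ≤ Re⟨N⟩_{β,μ} ≤ Re⟨N⟩_{β,μ_hi}` (monotonicity). [cite: Ruelle1969, §3.4] -/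
theorem re_gibbsState_totalNumber_mem_Icc_of_mem_Icc_chemPot {β : ℝ} (hβ : 0 < β) (t s U : ℝ)
    {μlo μhi μ : ℝ} (hμ : μ ∈ Set.Icc μlo μhi) :
    (gibbsState β (hubbardTorusTT' L t s U - (μ : ℂ) • totalNumber) totalNumber).re ∈
      Set.Icc ((gibbsState β (hubbardTorusTT' L t s U - (μlo : ℂ) • totalNumber) totalNumber).re)
        ((gibbsState β (hubbardTorusTT' L t s U - (μhi : ℂ) • totalNumber) totalNumber).re) :=
  ⟨re_gibbsState_totalNumber_mono_chemPot L hβ t s U hμ.1,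
    re_gibbsState_totalNumber_mono_chemPot L hβ t s U hμ.2⟩

/-- **Certified reading**: rows `lo ≤ Re⟨N⟩_{β,μ_lo}` and `Re⟨N⟩_{β,μ_hi} ≤ hi` bound the thermal particle
number on the whole `μ`-cell: `lo ≤ Re⟨N⟩_{β,μ} ≤ hi` for every `μ ∈ [μ_lo, μ_hi]` — the filling WINDOW of a
chemical-potential cell from its two endpoint rows. [cite: Ruelle1969, §3.4] -/
theorem re_gibbsState_totalNumber_mem_Icc_of_rows {β : ℝ} (hβ : 0 < β) (t s U : ℝ)
    {μlo μhi μ lo hi : ℝ} (hμ : μ ∈ Set.Icc μlo μhi)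
    (hlo : lo ≤ (gibbsState β (hubbardTorusTT' L t s U - (μlo : ℂ) • totalNumber) totalNumber).re)
    (hhi : (gibbsState β (hubbardTorusTT' L t s U - (μhi : ℂ) • totalNumber) totalNumber).re ≤ hi) :
    (gibbsState β (hubbardTorusTT' L t s U - (μ : ℂ) • totalNumber) totalNumber).re ∈ Set.Icc lo hi :=
  have h := re_gibbsState_totalNumber_mem_Icc_of_mem_Icc_chemPot L hβ t s U hμ
  ⟨hlo.trans h.1, h.2.trans hhi⟩

/-- **The set of chemical potentials realising a filling box is an interval between scan points**: if
`Re⟨N⟩_{β,μ}` lies in `[n₁L², n₂L²]` at `μ = μ_a` and at `μ = μ_b`, then at every `μ` between them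
(order convexity from monotonicity). [cite: Ruelle1969, §3.4] -/
theorem re_gibbsState_totalNumber_mem_Icc_of_mem_uIcc {β : ℝ} (hβ : 0 < β) (t s U : ℝ)
    {μa μb μ lo hi : ℝ} (hμ : μ ∈ Set.uIcc μa μb)
    (ha : (gibbsState β (hubbardTorusTT' L t s U - (μa : ℂ) • totalNumber) totalNumber).re ∈ Set.Icc lo hi)
    (hb : (gibbsState β (hubbardTorusTT' L t s U - (μb : ℂ) • totalNumber) totalNumber).re ∈ Set.Icc lo hi) :
    (gibbsState β (hubbardTorusTT' L t s U - (μ : ℂ) • totalNumber) totalNumber).re ∈ Set.Icc lo hi := by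
  rcases le_total μa μb with hab | hab
  · rw [Set.uIcc_of_le hab] at hμ
    exact re_gibbsState_totalNumber_mem_Icc_of_rows L hβ t s U hμ ha.1 hb.2
  · rw [Set.uIcc_of_ge hab] at hμ
    exact re_gibbsState_totalNumber_mem_Icc_of_rows L hβ t s U hμ hb.1 ha.2

end Cell

/-! ### §3 Dimensionless form -/

section Unit

/-- **The thermal particle number is a function of `(βt; t'/t, U/t, μ/t)`**: for `t > 0`,
`⟨N⟩_{β, H_L(t,t',U) − μN} = ⟨N⟩_{βt, H_L(1,t'/t,U/t) − (μ/t)N}` — the `μ`-cell of a physical box reads in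
`μ/t` against `k_BT/t` (zero-field case of `gibbsState_hubbardTorusTT'_grandCanonical_eq_unit`).
[cite: XuEtAl2024, eq. (1)] -/
theorem gibbsState_totalNumber_hubbardTorusTT'_grandCanonical_eq_unit (L : ℕ) (β : ℝ) {t : ℝ}
    (ht : 0 < t) (t' U μ : ℝ) :
    gibbsState β (hubbardTorusTT' L t t' U - (μ : ℂ) • totalNumber) totalNumber =
      gibbsState (β * t) (hubbardTorusTT' L 1 (t' / t) (U / t) - ((μ / t : ℝ) : ℂ) • totalNumber)
        totalNumber := by
  have h := gibbsState_hubbardTorusTT'_grandCanonical_eq_unit L β ht t' U μ 0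
  rw [zero_div] at h
  simp only [Complex.ofReal_zero, zero_smul, sub_zero] at h
  rw [h]

end Unit

end Literature.MathematicalPhysics.QuantumLattice
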